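import Summits.QuantumFields.YangMills.Theorems.BalabanUVNodesN22AtU3OfKernels
import Literature.MathematicalPhysics.QuantumFieldTheory.Balaban1983to89.T4BetaReadOutLipschitz
import Literature.MathematicalPhysics.QuantumFieldTheory.Balaban1983to89.T4BetaStationary
import Literature.MathematicalPhysics.QuantumFieldTheory.Balaban1983to89.T4CouplingMatching

/-!
# THE β-FUNCTIONS INHERIT HISTORY MODULI WITH FADING MEMORY FROM KERNEL-CURRENCY NE9 — THE DIRECT (cr-FREE) ROAD: node U2's `HistLipschitz` of the merged β
# from N22's kernel input at def-W1's `U3OfKernels` objects plus ONE (5.10) clause, via pv10∕t4's `secondMoment_sub_abs_le`; record instances (the S3 ∕ `ContRecord13` sentence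
# itself is dag-n17-w3's `…N17HistModuliContRecord13`, p597231 — LANDED FIRST, CITED)

Cell `pub-ymgap`, Track A (HUMAN RULING D-0062), WIDTH SEAT `dag-n22-w3` g2 on node n22 = NE9; `--kind proof --supports stmt-QuantumFields-20544 --as helper`,
COUNT-NEUTRAL.  PRIORITY NOTE (R455 (A)): the record-level SENTENCE «(D4) ∧ N22 at the kernel objects ⇒ `HistLipschitz` ⇒ `BetaContH θ.γ (betaOfRecord₁₃ …)` = K2⁷ v4
`ContRecord13`'s body» was CLAIMED FIRST and LANDED by seat dag-n17-w3 g2 (`Thm/BalabanUVNodesN17HistModuliContRecord13.lean`, p597231, ns `YMDAG.N17.HistModuliCont`: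
`histLipschitz_of_readOutAt_ne9`, `betaContH_betaOfRecord₁₃_of_kernels`, `contRecord13Body_of_kernels` — via `T4BetaReadOutLipschitz.histLipschitz_of_ne9_on` at the abstract
carriers and the (D4) closer, paying the read-out letter `ℓ.cr` and its rows).  By the split agreed on the bus (pub-ymgap INBOX, dag-n17-w3 l.≈27300) THIS file keeps the
SHARPER GENERIC ROAD only — NO `cr` row, NO `Signs`, NO `betaPrime510 ≤ cr`: the moduli come out as `betaPrime510 4 1 κ · Λ (k+1) i` from `0 < κ` + kernel NE9 + ONE (5.10) clause
— and its record instances under the stem `…_of_kernelNE9`; the K2⁷ line-2 consequence is CITED from p597231, not restated.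

THE OBSERVATION.  By (1.22) p. 264 ∕ (5.42) p. 297 the β-function of level `k + 1` on the box IS the second moment of the limiting kernel:
`betaMerged F ℰ ρ bV k v = Σ_z Π_{k+1,01}(extd v; z) z_0 z_1` (W1-19 `secondMoment_kernelA_extd`).  Hence kernel-currency NE9 — `|Π(g; z) − Π(g′; z)| ≤ e^{−κ|z|₁} Σ_{i≤k}
Λ (k+1) i |g_i − g′_i|` on the window (this seat's N22 input at (β), p593053) — together with ONE (5.10) clause (`KernelDecay … 0 1 κ`, the (D4) letter, for absolute
convergence) makes the DIFFERENCE kernel `z ↦ Π(extd v; z) − Π(extd v′; z)` a (5.10)-class kernel with constant `Σ_i Λ (k+1) i |v_i − v′_i|`, and pv10∕t4's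
`T4BetaReadOutLipschitz.secondMoment_sub_abs_le` («(5.42) IS LIPSCHITZ UNDER (5.10) FOR THE DIFFERENCE») gives
`|β_{k+1}(v) − β_{k+1}(v′)| ≤ betaPrime510 4 1 κ · Σ_i Λ (k+1) i |v_i − v′_i|` on the box `]0, γ]^{k+1}`: node U2's UNPRINTED input
`T4CouplingMatching.HistLipschitz (fun k i => betaPrime510 4 1 κ · Λ (k+1) i) γ` (GAPS G-t4-U2-2, «moduli for the dependence on EACH coupling») — WITH FADING MEMORY when `Λ` has it —
and, by `T4BetaStationary.betaContH_of_histLipschitz`, the box continuity `FlowStep.BetaContH γ` of `betaOfMerged (betaMerged F ℰ ρ bV) β0 γ`.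

* §1 generic term family: `decay510_kernelA_extd_sub_of_ne9` · ★ `abs_betaMerged_sub_le_of_ne9` · ★ `histLipschitz_betaMerged_of_ne9` (any box side `γ′`: the merged β's
  `HistLipschitz` = the 2nd conjunct of the tree's `U2Inputs`) · ★ `histLipschitz_betaOfMerged_of_ne9` · `fadingMemory_histModuli_of_fadingMemory`
  (`FadingMemory C₉ ω (Λ)` in node U3's shifted indexing ⇒ `T4CouplingMatching.FadingMemory (betaPrime510 4 1 κ · C₉ · ω) ω` of the β-moduli) · ★ `betaContH_betaOfMerged_of_ne9`.
* §2 at the record (`objectsOfRecord₁₃ F N θ ℓ`, `betaOfRecord₁₃ F N θ`), cr-FREE instances: ★★ `histLipschitz_betaOfRecord₁₃_of_kernelNE9`, `betaContH_betaOfRecord₁₃_of_kernelNE9`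
  (the SAME sentence as p597231's `betaContH_betaOfRecord₁₃_of_kernels`, from FEWER letters — cited, different FQN), `histLipschitz_fadingMemory_betaOfRecord₁₃_of_kernelNE9`
  (letter-block edition with FADING MEMORY), ★★ `histLipschitz_fadingMemory_betaMerged_record_of_kernelNE9` (node U2's input PAIR on a box side `γ′` in
  `…N17AtRecord13Sep.u2Inputs_datumOfRecord₁₃Sep_iff`'s shape) — from `0 < κ`, NE9 of the kernel functional of record with moduli `Λ`, (5.10) on the window.

HONEST FRAMING (binding).  Bookkeeping over LANDED analysis (`secondMoment_sub_abs_le`'s dominated summation, `betaContH_of_histLipschitz`); THEOREMS ONLY (0 def, 0 sorry,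
standard axioms).  Kernel-currency NE9 and the (5.10) clause STAY DISPLAYED HYPOTHESES (NOT PRINTED for d = 4 ∕ printed TYPE resp.); nothing of Bałaban's asserted; K2⁷'s
`stub_cont13` is NOT proved (its reduction to K3⁷'s kernel letters is p597231's located sentence); N22 NOT discharged; K2⁷ ∕ K3⁷ OPEN, not claimed; no count claim; one
finite 𝕋⁴ programme at fixed ε — R4 closes the conditional rung `BalabanLadder.UV` only; NOTHING about the continuum limit, ℝ⁴, OS axioms, a mass gap or Clay is proved or claimed.
TYPES only: [I] = [Balaban1987RG1] (1.20)–(1.22) p. 264, (5.10) p. 293, (5.42) p. 297, §5 p. 298.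
-/

noncomputable section

open Filter Topology
open scoped BigOperators

namespace YMDAG.N22.AtKernels

open Literature.MathematicalPhysics.QuantumFieldTheory.Balaban1983to89
open Literature.MathematicalPhysics.QuantumFieldTheory.Balaban1983to89.T4Continuum (T4Family)
open Literature.MathematicalPhysics.QuantumFieldTheory.Balaban1983to89.T4OutputRate (Window NE9)
open Literature.MathematicalPhysics.QuantumFieldTheory.Balaban1983to89.FlowStep (Box HBeta BetaContH)
open Literature.MathematicalPhysics.QuantumFieldTheory.Balaban1983to89.T4FlagMemory (extd extd_coe)
open Literature.MathematicalPhysics.QuantumFieldTheory.Balaban1983to89.T4BetaReadOut (extd_mem_window)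
open Literature.MathematicalPhysics.QuantumFieldTheory.Balaban1983to89.T4CouplingMatching (HistLipschitz)
open Literature.MathematicalPhysics.QuantumFieldTheory.Balaban1983to89.T4BetaStationary (betaContH_of_histLipschitz)
open Literature.MathematicalPhysics.QuantumFieldTheory.Balaban1983to89.T4BetaReadOutLipschitz (secondMoment_sub_abs_le)
open Literature.MathematicalPhysics.QuantumFieldTheory.Balaban1983to89.Node00 (TermFamily1 betaMerged betaOfMerged betaOfRecord₁₃ Stage13Params U3Letters₁₁)
open Literature.MathematicalPhysics.QuantumFieldTheory.Balaban1983to89.Node00.U3OfKernels (kernelA EA objectsOfRecord₁₃ ne9_EA_iff secondMoment_kernelA_extd KernelDecay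
  KernelDecayOfRecord₁₃)
open Literature.MathematicalPhysics.QuantumFieldTheory.Balaban1983to89.B12Sec2to5 (l1 Decay510 betaPrime510)

/-! ## §1 Generic term family: kernel NE9 ⇒ history moduli of β with the read-out constant `betaPrime510 4 1 κ` -/

section Generic

variable {𝔄 : Type*} [NormedRing 𝔄] [NormedAlgebra ℝ 𝔄]
variable {V : Type*} [NormedAddCommGroup V] [NormedSpace ℝ V] {ι : Type*} [Fintype ι]
variable (F : T4Family) (ℰ : TermFamily1 F 𝔄) (ρ : V →L[ℝ] 𝔄) (bV : Module.Basis ι ℝ V)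

/-- **THE DIFFERENCE KERNEL AT TWO BOX HISTORIES IS A (5.10)-CLASS KERNEL WITH CONSTANT `Σ_i Λ (k+1) i |v_i − v′_i|`** under kernel-currency NE9 on the window. -/
theorem decay510_kernelA_extd_sub_of_ne9 {γ κ : ℝ} {Λ : ℕ → ℕ → ℝ} (h9 : NE9 (EA F ℰ ρ bV) (Window γ) κ Λ) {k : ℕ}
    {v v' : Fin (k + 1) → ℝ} (hv : v ∈ Box γ k) (hv' : v' ∈ Box γ k) (μ ν : Fin 4) :
    Decay510 (fun z => kernelA F ℰ ρ bV (extd v) k μ ν z - kernelA F ℰ ρ bV (extd v') k μ ν z) (∑ i : Fin (k + 1), Λ (k + 1) i * |v i - v' i|) κ := by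
  intro z
  have h := (ne9_EA_iff F ℰ ρ bV (Window γ) κ Λ).1 h9 (extd v) (extd_mem_window hv) (extd v') (extd_mem_window hv') k μ ν z
  rw [← Fin.sum_univ_eq_sum_range (fun i => Λ (k + 1) i * |extd v i - extd v' i|) (k + 1)] at h
  simp only [extd_coe] at h
  rw [neg_mul, mul_comm (∑ i : Fin (k + 1), Λ (k + 1) i * |v i - v' i|)]
  exact h

/-- ★ **HISTORY-LIPSCHITZ BOUND OF THE MERGED β ON THE BOX FROM KERNEL NE9 + ONE (5.10) CLAUSE**: for `0 < κ`,
`|β_{k+1}(v) − β_{k+1}(v′)| ≤ betaPrime510 4 1 κ · Σ_i Λ (k+1) i |v_i − v′_i|` (`betaMerged = secondMoment ∘ kernelA ∘ extd` at the pair `(0,1)`;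
pv10∕t4 `secondMoment_sub_abs_le`). -/
theorem abs_betaMerged_sub_le_of_ne9 {γ κ : ℝ} {Λ : ℕ → ℕ → ℝ} (hκ : 0 < κ) (h9 : NE9 (EA F ℰ ρ bV) (Window γ) κ Λ)
    (hdec : KernelDecay F ℰ ρ bV (Window γ) 0 1 κ) {k : ℕ} {v v' : Fin (k + 1) → ℝ} (hv : v ∈ Box γ k) (hv' : v' ∈ Box γ k) :
    |betaMerged F ℰ ρ bV k v - betaMerged F ℰ ρ bV k v'| ≤ betaPrime510 4 1 κ * ∑ i : Fin (k + 1), Λ (k + 1) i * |v i - v' i| := by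
  obtain ⟨C₀, hC₀⟩ := hdec (extd v) (extd_mem_window hv)
  obtain ⟨C₀', hC₀'⟩ := hdec (extd v') (extd_mem_window hv')
  have h := secondMoment_sub_abs_le (Pk := kernelA F ℰ ρ bV (extd v) k) (Pk' := kernelA F ℰ ρ bV (extd v') k) hκ (hC₀ k) (hC₀' k)
    (decay510_kernelA_extd_sub_of_ne9 F ℰ ρ bV h9 hv hv' 0 1)
  rw [secondMoment_kernelA_extd, secondMoment_kernelA_extd] at h
  refine h.trans (le_of_eq ?_)
  simp only [betaPrime510, one_mul]
  ring

/-- ★ **node U2's `HistLipschitz` OF THE MERGED β `betaMerged F ℰ ρ bV` ON ANY BOX SIDE `γ′`** from kernel NE9 + one (5.10) clause ON THE WINDOW `]0, γ′]^ℕ`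
(moduli `betaPrime510 4 1 κ · Λ (k+1) i`) — the SECOND conjunct of the tree's `U2Inputs … γ′ Λ′` at a datum whose β is the merged β (`…N17AtRecord13Sep.u2Inputs_datumOfRecord₁₃Sep_iff`). -/
theorem histLipschitz_betaMerged_of_ne9 {γ κ : ℝ} {Λ : ℕ → ℕ → ℝ} (hκ : 0 < κ) (h9 : NE9 (EA F ℰ ρ bV) (Window γ) κ Λ)
    (hdec : KernelDecay F ℰ ρ bV (Window γ) 0 1 κ) :
    HistLipschitz (fun k i => betaPrime510 4 1 κ * Λ (k + 1) i) γ (betaMerged F ℰ ρ bV) := by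
  intro k p q hp hq
  refine (abs_betaMerged_sub_le_of_ne9 F ℰ ρ bV hκ h9 hdec hp hq).trans (le_of_eq ?_)
  rw [Finset.mul_sum]
  refine Finset.sum_congr rfl fun i _ => ?_
  ring

/-- ★ **node U2's `HistLipschitz` OF THE β OF RECORD'S SHAPE `betaOfMerged (betaMerged F ℰ ρ bV) β0 γ` FROM KERNEL NE9** (moduli `betaPrime510 4 1 κ · Λ (k+1) i` in U2's level-`k`
indexing; on the box `betaOfMerged` IS `betaMerged`, `betaOfMerged_of_mem`). -/
theorem histLipschitz_betaOfMerged_of_ne9 {γ κ : ℝ} {Λ : ℕ → ℕ → ℝ} (hκ : 0 < κ) (h9 : NE9 (EA F ℰ ρ bV) (Window γ) κ Λ)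
    (hdec : KernelDecay F ℰ ρ bV (Window γ) 0 1 κ) (β0 : ℕ → ℝ) :
    HistLipschitz (fun k i => betaPrime510 4 1 κ * Λ (k + 1) i) γ (betaOfMerged (betaMerged F ℰ ρ bV) β0 γ) := by
  intro k p q hp hq
  rw [Node00.betaOfMerged_of_mem _ _ _ hp, Node00.betaOfMerged_of_mem _ _ _ hq]
  refine (abs_betaMerged_sub_le_of_ne9 F ℰ ρ bV hκ h9 hdec hp hq).trans (le_of_eq ?_)
  rw [Finset.mul_sum]
  refine Finset.sum_congr rfl fun i _ => ?_
  ring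

/-- **FADING MEMORY IS INHERITED**: node U3's fading-memory letter `T4OutputRate.FadingMemory C₉ ω Λ` (`0 ≤ Λ a i ≤ C₉ ω^{a−i}`, `i ≤ a`) at the SHIFTED index `a = k + 1`
gives node U2's `T4CouplingMatching.FadingMemory (M · C₉ · ω) ω (fun k i => M · Λ (k+1) i)` for every `M ≥ 0` (here `M = betaPrime510 4 1 κ`). -/
theorem fadingMemory_histModuli_of_fadingMemory {C₉ ω M : ℝ} {Λ : ℕ → ℕ → ℝ} (hM : 0 ≤ M) (h : T4OutputRate.FadingMemory C₉ ω Λ) :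
    T4CouplingMatching.FadingMemory (M * C₉ * ω) ω (fun k i => M * Λ (k + 1) i) := by
  intro k i hik
  obtain ⟨h0, h1⟩ := h (k + 1) i (Nat.le_succ_of_le hik)
  refine ⟨mul_nonneg hM h0, ?_⟩
  have e : ω ^ (k + 1 - i) = ω * ω ^ (k - i) := by
    rw [Nat.succ_sub hik, pow_succ, mul_comm]
  calc M * Λ (k + 1) i ≤ M * (C₉ * ω ^ (k + 1 - i)) := mul_le_mul_of_nonneg_left h1 hM
    _ = M * C₉ * ω * ω ^ (k - i) := by rw [e]; ring

/-- ★ **THE BOX CONTINUITY OF THE β OF RECORD'S SHAPE FROM KERNEL NE9** (`T4BetaStationary.betaContH_of_histLipschitz`): K2⁷'s «stub_cont13» letter `BetaContH γ`, generic. -/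
theorem betaContH_betaOfMerged_of_ne9 {γ κ : ℝ} {Λ : ℕ → ℕ → ℝ} (hκ : 0 < κ) (h9 : NE9 (EA F ℰ ρ bV) (Window γ) κ Λ)
    (hdec : KernelDecay F ℰ ρ bV (Window γ) 0 1 κ) (β0 : ℕ → ℝ) : BetaContH γ (betaOfMerged (betaMerged F ℰ ρ bV) β0 γ) :=
  betaContH_of_histLipschitz (histLipschitz_betaOfMerged_of_ne9 F ℰ ρ bV hκ h9 hdec β0)

end Generic

/-! ## §2 At the record, Stage 13: `betaOfRecord₁₃ F N θ` from the kernel functional of record -/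

section Record

open scoped Matrix.Norms.L2Operator

variable (F : T4Family) (N : ℕ) [NeZero N]

/-- ★★ **node U2's `HistLipschitz` OF THE β-FUNCTIONS OF RECORD `betaOfRecord₁₃ F N θ` FROM KERNEL-CURRENCY NE9 OF THE FUNCTIONAL OF RECORD + THE (5.10) CLAUSE OF RECORD**
(moduli `betaPrime510 4 1 κ · Λ (k+1) i`; LOCATED — both inputs displayed; level-free objects: `.EA 0`). -/
theorem histLipschitz_betaOfRecord₁₃_of_kernelNE9 (θ : Stage13Params F N) (ℓ : U3Letters₁₁) {κ : ℝ} {Λ : ℕ → ℕ → ℝ} (hκ : 0 < κ)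
    (h9 : NE9 ((objectsOfRecord₁₃ F N θ ℓ).EA 0) (Window θ.γ) κ Λ) (hdec : KernelDecayOfRecord₁₃ F N θ 0 1 κ) :
    HistLipschitz (fun k i => betaPrime510 4 1 κ * Λ (k + 1) i) θ.γ (betaOfRecord₁₃ F N θ) := by
  letI := θ.instVβ₁; letI := θ.instVβ₂; letI := θ.instιβ
  exact histLipschitz_betaOfMerged_of_ne9 F _ θ.ρ8 θ.bV hκ h9 hdec _

/-- **THE BOX-CONTINUITY LETTER AT THE RECORD, cr-FREE EDITION** (the sentence is dag-n17-w3's `YMDAG.N17.HistModuliCont.betaContH_betaOfRecord₁₃_of_kernels`, p597231, landed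
first; here from fewer letters): `BetaContH θ.γ (betaOfRecord₁₃ F N θ)` — the body of v4's `ContRecord13` at a Stage-13 tuple
(`betaOfRecord₁₃` unfolds to v4's displayed `betaOfMerged (betaMerged F (mergedTermFamilyMatT F N (TcanOfRecord F N) (chiFixed29 F N θ.ν θ.ε₂₉) θ.εbg) θ.ρ8 θ.bV) …` by `rfl`) —
from `0 < κ`, kernel-currency NE9 of the functional of record (N22's input at (β)) and `KernelDecayOfRecord₁₃ F N θ 0 1 κ` ((D4)'s input).  LOCATED; `stub_cont13` NOT proved. -/
theorem betaContH_betaOfRecord₁₃_of_kernelNE9 (θ : Stage13Params F N) (ℓ : U3Letters₁₁) {κ : ℝ} {Λ : ℕ → ℕ → ℝ} (hκ : 0 < κ)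
    (h9 : NE9 ((objectsOfRecord₁₃ F N θ ℓ).EA 0) (Window θ.γ) κ Λ) (hdec : KernelDecayOfRecord₁₃ F N θ 0 1 κ) :
    BetaContH θ.γ (betaOfRecord₁₃ F N θ) :=
  betaContH_of_histLipschitz (histLipschitz_betaOfRecord₁₃_of_kernelNE9 F N θ ℓ hκ h9 hdec)

/-- The letter-block edition: with `ℓ.Signs`, N22's moduli `ℓ.moduli` and `0 < ℓ.κ`, the β of record has node U2's history moduli
`betaPrime510 4 1 ℓ.κ · ℓ.C₉ ω^{k+1−i}` WITH FADING MEMORY `T4CouplingMatching.FadingMemory (betaPrime510 4 1 ℓ.κ · ℓ.C₉ · ℓ.ω) ℓ.ω` — the input pair of node U2's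
`disc_le_of_fadingMemory` at the record, REDUCED to the kernel letters.  LOCATED. -/
theorem histLipschitz_fadingMemory_betaOfRecord₁₃_of_kernelNE9 (θ : Stage13Params F N) (ℓ : U3Letters₁₁) (hs : ℓ.Signs) (hκ : 0 < ℓ.κ)
    (h9 : NE9 ((objectsOfRecord₁₃ F N θ ℓ).EA 0) (Window θ.γ) ℓ.κ ℓ.moduli) (hdec : KernelDecayOfRecord₁₃ F N θ 0 1 ℓ.κ) :
    HistLipschitz (fun k i => betaPrime510 4 1 ℓ.κ * ℓ.moduli (k + 1) i) θ.γ (betaOfRecord₁₃ F N θ) ∧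
      T4CouplingMatching.FadingMemory (betaPrime510 4 1 ℓ.κ * ℓ.C₉ * ℓ.ω) ℓ.ω (fun k i => betaPrime510 4 1 ℓ.κ * ℓ.moduli (k + 1) i) := by
  refine ⟨histLipschitz_betaOfRecord₁₃_of_kernelNE9 F N θ ℓ hκ h9 hdec, ?_⟩
  have hM : 0 ≤ betaPrime510 4 1 ℓ.κ := by
    unfold betaPrime510
    rw [one_mul]
    exact tsum_nonneg fun x => mul_nonneg (sq_nonneg _) (Real.exp_nonneg _)
  exact fadingMemory_histModuli_of_fadingMemory hM (fun a i _ => ⟨hs.moduli_nonneg a i, le_rfl⟩)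

/-- ★★ **node U2's INPUT PAIR (history moduli ∧ fading memory) FOR THE MERGED β OF RECORD ON A BOX SIDE `γ′`, FROM THE KERNEL LETTERS ON `]0, γ′]^ℕ`** — the second
and third conjuncts of `U2Inputs (datumOfRecord₁₃Sep F N θ h) c (betaPrime510 4 1 κ · C₉ · ω) ω γ′ Λ′` in the shape of `…N17AtRecord13Sep.u2Inputs_datumOfRecord₁₃Sep_iff`
(`TβOfRecord₁₃ = TcanOfRecord` is an `abbrev`; the kernel functional of record IS `U3OfKernels.EA` at the merged family of record, `rfl`): moduli
`Λ′ k i = betaPrime510 4 1 κ · Λ (k+1) i` with `FadingMemory (betaPrime510 4 1 κ · C₉ · ω) ω Λ′` whenever node U3's `FadingMemory C₉ ω Λ` holds.  LOCATED (hypothesis form). -/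
theorem histLipschitz_fadingMemory_betaMerged_record_of_kernelNE9 (θ : Stage13Params F N) (ℓ : U3Letters₁₁) {γ' κ C₉ ω : ℝ} {Λ : ℕ → ℕ → ℝ} (hκ : 0 < κ)
    (h9 : NE9 ((objectsOfRecord₁₃ F N θ ℓ).EA 0) (Window γ') κ Λ)
    (hdec : letI := θ.instVβ₁; letI := θ.instVβ₂; letI := θ.instιβ
      KernelDecay F (Node00.mergedTermFamilyMatT F N (Node00.TβOfRecord₁₃ F N) (Node00.chiβOfRecord₁₃ F N θ) θ.εbg) θ.ρ8 θ.bV (Window γ') 0 1 κ)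
    (hΛ : T4OutputRate.FadingMemory C₉ ω Λ) :
    letI := θ.instVβ₁; letI := θ.instVβ₂; letI := θ.instιβ
    HistLipschitz (fun k i => betaPrime510 4 1 κ * Λ (k + 1) i) γ'
        (betaMerged F (Node00.mergedTermFamilyMatT F N (Node00.TcanOfRecord F N) (Node00.chiβOfRecord₁₃ F N θ) θ.εbg) θ.ρ8 θ.bV) ∧
      T4CouplingMatching.FadingMemory (betaPrime510 4 1 κ * C₉ * ω) ω (fun k i => betaPrime510 4 1 κ * Λ (k + 1) i) := by
  letI := θ.instVβ₁; letI := θ.instVβ₂; letI := θ.instιβ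
  have hM : 0 ≤ betaPrime510 4 1 κ := by
    unfold betaPrime510
    rw [one_mul]
    exact tsum_nonneg fun x => mul_nonneg (sq_nonneg _) (Real.exp_nonneg _)
  exact ⟨histLipschitz_betaMerged_of_ne9 F _ θ.ρ8 θ.bV hκ h9 hdec, fadingMemory_histModuli_of_fadingMemory hM hΛ⟩

end Record


end YMDAG.N22.AtKernels

end
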